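import Literature.NumberTheory.LFunctions.Zhang2022.Section12ShiftedSmallCircle
import Literature.NumberTheory.LFunctions.Zhang2022.Section12ShiftedContour
import Literature.NumberTheory.LFunctions.Zhang2022.Section5Lemma57
import HarnessLib

/-!
# Zhang (2022) §12, Lemmas 12.2–12.3: the small circle around `s = β₆ − w` WITH the Gaussian factor `ω₁`
# — the one-call evaluation of `(2πi)⁻¹∮_{C(β₆−w,3α)} Φ(z)·Y^z ω₁(z)/z dz` (theorems only)

Topic `Literature/NumberTheory/LFunctions/Zhang2022` (Landau–Siegel audit tree; verdict-neutral).
Y. Zhang, *Discrete mean estimates and the Landau–Siegel zero*, arXiv:2211.02515v1 (2022)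
[Zhang2022LandauSiegel] — **an unrefereed manuscript under adjudication** (lane ZHANG-L, WP12, helper row
«H-b / E2‴» under the cores `Typed.Sec12B.U025Rel` (leaf h1212) and `U030Rel` (leaf hTop25Ex)). Everything in
this file is PROVED (theorems only; no new definitions, no new named facts); nothing here is a claim about
Theorems 1–2 of the source or about Landau–Siegel zeros.

DAG nodes served: `Z22:§12.u025` (proof of Lemma 12.2, p. 69, tex L3534) and `Z22:§12.u030` (proof of
Lemma 12.3, p. 70, tex L3564): "In a way similar to the proof of Lemma 8.4, by lemma 8.2 and 5.8, we find that
[the Perron integral on `(1)`] is equal to `L′(1,χ)Π(d,r)·(2πi)⁻¹∫_{|s|=5α}(…)ds/s + O(𝓛⁻¹⁵)`". The lane's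
shared route (ruling S-8): big Landau contour for the shifted quotient
`Φ(z) = 𝔲(u)L(u+β_{j+1},χ)L(u+β_{j+2},χ)/L(u,χ)`, `u = 1 − β₆ + w + z`, against the kernel `Y^zω₁(z)/z`
(`ShiftedContour.norm_vline_sub_circ_le`, file `Section12ShiftedContour`) lands on the SMALL CIRCLE
`C(β₆ − w, 3α)` with the SAME kernel `Y^{z+0}ω₁(z+0)/(z+0)`; this file evaluates that circle integral:

* `norm_model_on_shifted_sphere_le` — the size of the MODEL `Π(d,r)L′(1,χ)(z+w−β₆+β_{j+1})(z+w−β₆+β_{j+2})/(z+w−β₆)`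
  on the circle: `≤ Π̂²·2e^{9/2}(1+𝓛)𝓛·K²α/3` (`Π̂ = ∏_{q∣dr}(1−q⁻¹)⁻¹`, `K ≥ 7 + 15|c′|`);
* `norm_true_on_shifted_sphere_le` (zl-w12-p10's cut «H-b») — the sup of the TRUE quotient on the circle:
  `‖Φ(z)‖ ≤ M_K,C₈₃·Π̂²` with the explicit absolute
  `M = (1+16e^{9/2}π²K²)(24K²+2K) + 128e^{9/2}πK³C₈₃ + 2e^{9/2}K²π` (model size + the pointwise comparison
  `Lemma84.norm_quot_sub_model_on_shifted_sphere`);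
* `continuousOn_true_on_shifted_sphere` — `Φ` is continuous on the circle (`L(u,χ) ≠ 0` there by
  `Lemma84.LFunction_ne_zero_on_shifted_sphere`);
* **`norm_circ_omega1_true_sub_main_kernel1`** — for `1 ≤ Y ≤ P`, `Λ ≥ 1`:
  `‖(2πi)⁻¹∮_{C(β₆−w,3α)} Φ(z)·Y^{z+0}ω₁ Λ (z+0)/(z+0) dz − Π(d,r)L′(1,χ)·(w − β₆ + β_{j+1} + β_{j+2}
     + β_{j+1}β_{j+2}(Y^{β₆−w} − 1)/(β₆−w))‖ ≤ C_{K,C₈₃}·Π̂²·𝓛⁻¹⁵`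
  = zl-libB-p5's `ω₁`-removal `ShiftedContour.norm_circ_omega1_sub_le` (glue `O(M·α²/Λ)`) + H-b + the
  bare-kernel evaluation `Lemma84.norm_circ_true_sub_main_kernel1` (file `Section12ShiftedSmallCircle`); the
  value subtracted is `Π L′(1,χ)·circ030` (`Typed.Sec12B.U031_holds`);
* `norm_circ_omega1_pair_sub_main` — the u025 form: the DIFFERENCE of the two circle integrals at `Y₂`, `Y₁`
  against `Π(d,r)L′(1,χ)·β_{j+1}β_{j+2}(Y₂^{β₆−w} − Y₁^{β₆−w})/(β₆−w)` (`= Π L′·circ025`,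
  `Typed.Sec12B.circ025_eq`), error `2C_{K,C₈₃}·Π̂²·𝓛⁻¹⁵`;
* `circ_omega1_eval_forAllLarge` / `circ_omega1_pair_eval_forAllLarge` — the same two statements with every
  numerical side condition (`K = 7 + 15|c′|`, `ℓ₀ = e⁻¹/4 ≤ |L′(1,χ)|` by Lemma 5.7, `Kπ ≤ 𝓛⁸`,
  `(1+16e^{9/2}π²K²)𝓛⁻¹⁵ ≤ ℓ₀α/4`, `α < 1/30`, `𝓛 ≥ 3`) discharged under the lane's standing quantifier
  `ForAllLarge` + (A): the consumer supplies only the continuation `𝔲` with Lemma 8.3 (i), (iii′)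
  (`Skeleton.Lemma83Rel`, a theorem of the tree: `Skeleton.lemma83Rel_holds`), `|w| = α`, `1 ≤ Y ≤ P`, `Λ ≥ 1`.

How the two cores use it: u030 = unsmoothing (`XiZeroMajorant.xi_sharp_sub_smooth_le`) + Perron
(`GaussWeight.integral_LSeries_mul_kernel`) + `ShiftedContour.norm_vline_sub_circ_le` + `…_kernel1` here +
`Typed.Sec12B.U031_holds`; u025 = `ShiftedContour.norm_vline_sub_circ_le` at `Y₂ = P″₂/dr` and `Y₁ = P″₁/dr` +
`norm_circ_omega1_pair_sub_main` here + `Typed.Sec12B.circ025_eq`. WHAT THIS IS NOT: a proof of u025/u030,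
nor a statement about which error term is derivable — the factor `Π̂²` (row G-d55-3) is carried throughout.
«ZHANG-L proves typed steps of arXiv:2211.02515v1 in Lean; the §18 margin is refuted as printed (G-C1); no
claim about Landau–Siegel zeros or Theorem 2 follows from this lane.»

## References

* Y. Zhang, arXiv:2211.02515v1 (2022), §12 proofs of Lemmas 12.2–12.3, pp. 69–70, tex L3528–L3586; §8
  Lemma 8.4 (proof), p. 47; §5 Lemmas 5.7, 5.8; §4 (4.1) (`ω₁`). [cite: Zhang2022LandauSiegel, §12 Lemmas 12.2–12.3]
* H. L. Montgomery, R. C. Vaughan, *Multiplicative Number Theory I*, CUP 2007, §6.2.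
  [cite: MontgomeryVaughan2007, §6.2]
-/

noncomputable section

open Complex Real Set Finset Metric

namespace Literature.NumberTheory.LFunctions.Zhang2022.Lemma84

open Skeleton GaussWeight

section ShiftedCircleOmega

variable {D : ℕ}

/-- `Π̂ = ∏_{q∣n}(1 − q⁻¹)⁻¹ ≥ 1`. [cite: Zhang2022LandauSiegel, §8 Lemma 8.3] -/
private theorem one_le_hatPi' (n : ℕ) : 1 ≤ ∏ q ∈ n.primeFactors, (1 - (q : ℝ)⁻¹)⁻¹ := by
  refine le_of_eq_of_le (Finset.prod_const_one (s := n.primeFactors)).symm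
    (Finset.prod_le_prod (fun _ _ => zero_le_one) fun q hq => ?_)
  have hq2 : (2 : ℝ) ≤ q := by exact_mod_cast (Nat.prime_of_mem_primeFactors hq).two_le
  have h1 : 0 < 1 - (q : ℝ)⁻¹ := by
    have : (q : ℝ)⁻¹ ≤ 1 / 2 := by rw [inv_eq_one_div]; gcongr
    linarith
  have h2 : 1 - (q : ℝ)⁻¹ ≤ 1 := by
    have : 0 ≤ (q : ℝ)⁻¹ := by positivity
    linarith
  exact (one_le_inv₀ h1).mpr h2

/-- **The size of the MODEL on the circle `|z − (β₆ − w)| = 3α`** (`|w| = α`, `K ≥ 7 + 15|c′|`, `𝓛 ≥ 3`):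
`‖Π(d,r)L′(1,χ)(z+w−β₆+β_{j+1})(z+w−β₆+β_{j+2})/(z+w−β₆)‖ ≤ Π̂²·(2e^{9/2}(1+𝓛)𝓛)·K²α/3`
(`|z+w−β₆| = 3α`, `|z+w−β₆+β| ≤ 3α + 3α(1+5|c′|) ≤ Kα`, `‖Π‖ ≤ Π̂²`, `|L′(1,χ)| ≤ 2e^{9/2}(1+𝓛)𝓛`).
[cite: Zhang2022LandauSiegel, §12 proof of Lemma 12.3, p. 70 ("direct calculation")] -/
theorem norm_model_on_shifted_sphere_le [NeZero D] (χ : DirichletCharacter ℂ D) (c' : ℝ)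
    (hprim : χ.IsPrimitive) (h𝓛 : 3 ≤ Real.log D) (j : ℕ) {d r : ℕ} (hd : d ≠ 0) (hr : r ≠ 0)
    {K : ℝ} (hK : 7 + 15 * |c'| ≤ K) {w : ℂ} (hw : ‖w‖ = alpha D) {z : ℂ}
    (hz : z ∈ sphere (beta6 D - w) (3 * alpha D)) :
    ‖PiW χ d r * deriv χ.LFunction 1 * (z + w - beta6 D + betaJ c' D (j + 1)) *
        (z + w - beta6 D + betaJ c' D (j + 2)) / (z + w - beta6 D)‖ ≤
      (∏ q ∈ (d * r).primeFactors, (1 - (q : ℝ)⁻¹)⁻¹) ^ 2 *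
        (2 * Real.exp (9 / 2) * (1 + Real.log D) * Real.log D) * (K ^ 2 * alpha D / 3) := by
  have hℓ1 : 1 ≤ ell D := by rw [ell]; linarith
  have hℓ2 : 2 ≤ ell D := by rw [ell]; linarith
  have hα : 0 < alpha D := alpha_pos' (by linarith)
  have hαℓ : alpha D * ell D ≤ 1 := alpha_mul_ell_le_one hℓ2
  obtain ⟨h1, -, -, -⟩ := sphere_shift_bounds hα hw hz
  -- sizes of the shifts
  have hβ : ∀ i : ℕ, ‖betaJ c' D i‖ ≤ 3 * alpha D * (1 + 5 * |c'|) := by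
    intro i
    have h := norm_betaJ_le c' D i hα.le (by linarith : 0 ≤ ell D)
    refine h.trans ?_
    have : 5 * |c'| * alpha D * ell D ≤ 5 * |c'| := by
      calc 5 * |c'| * alpha D * ell D = 5 * |c'| * (alpha D * ell D) := by ring
        _ ≤ 5 * |c'| * 1 := by gcongr
        _ = 5 * |c'| := mul_one _
    nlinarith [abs_nonneg c']
  have hA : ∀ i : ℕ, ‖z + w - beta6 D + betaJ c' D i‖ ≤ K * alpha D := by
    intro i
    calc ‖z + w - beta6 D + betaJ c' D i‖ ≤ ‖z + w - beta6 D‖ + ‖betaJ c' D i‖ := norm_add_le _ _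
      _ ≤ 3 * alpha D + 3 * alpha D * (1 + 5 * |c'|) := add_le_add h1.le (hβ i)
      _ ≤ K * alpha D := by nlinarith [abs_nonneg c']
  have hPi : ‖PiW χ d r‖ ≤ (∏ q ∈ (d * r).primeFactors, (1 - (q : ℝ)⁻¹)⁻¹) ^ 2 :=
    norm_PiW_le_prodInv χ hd hr
  have hℓle : ‖deriv χ.LFunction 1‖ ≤ 2 * Real.exp (9 / 2) * (1 + Real.log D) * Real.log D :=
    Lemma31.norm_deriv_LFunction_le_near_one χ h𝓛 hprim (w := 1)
      (by rw [sub_self, norm_zero]; positivity)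
  have hK0 : 0 ≤ K := by linarith [abs_nonneg c']
  rw [norm_div, norm_mul, norm_mul, norm_mul, h1]
  rw [div_le_iff₀ (by positivity)]
  have hnum : ‖PiW χ d r‖ * ‖deriv χ.LFunction 1‖ * ‖z + w - beta6 D + betaJ c' D (j + 1)‖ *
        ‖z + w - beta6 D + betaJ c' D (j + 2)‖ ≤
      (∏ q ∈ (d * r).primeFactors, (1 - (q : ℝ)⁻¹)⁻¹) ^ 2 *
        (2 * Real.exp (9 / 2) * (1 + Real.log D) * Real.log D) * (K * alpha D) * (K * alpha D) := by
    have h0 : 0 ≤ (∏ q ∈ (d * r).primeFactors, (1 - (q : ℝ)⁻¹)⁻¹) ^ 2 := by positivity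
    have h2 : 0 ≤ 2 * Real.exp (9 / 2) * (1 + Real.log D) * Real.log D := by positivity
    have hab : ‖PiW χ d r‖ * ‖deriv χ.LFunction 1‖ ≤
        (∏ q ∈ (d * r).primeFactors, (1 - (q : ℝ)⁻¹)⁻¹) ^ 2 *
          (2 * Real.exp (9 / 2) * (1 + Real.log D) * Real.log D) :=
      mul_le_mul hPi hℓle (norm_nonneg _) h0
    have habc := mul_le_mul hab (hA (j + 1)) (norm_nonneg _) (mul_nonneg h0 h2)
    exact mul_le_mul habc (hA (j + 2)) (norm_nonneg _) (by positivity)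
  refine hnum.trans (le_of_eq ?_)
  ring

/-- **H-b: the sup of the TRUE quotient on the circle `|z − (β₆ − w)| = 3α`.** Under the hypotheses of
`Lemma84.norm_quot_sub_model_on_shifted_sphere` (`χ` primitive, `𝓛 ≥ 3`, (A), `K ≥ 7 + 15|c′|`, `Kπ ≤ 𝓛⁸`,
`0 < ℓ₀ ≤ |L′(1,χ)|`, `(1+16e^{9/2}π²K²)𝓛⁻¹⁵ ≤ ℓ₀α/4`, `‖𝔲(u) − Π(d,r)‖ ≤ C₈₃𝓛⁻⁸Π̂` on `|u − 1| ≤ 5α`) and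
`|w| = α`: for every `z` on the circle, with `u = 1 − β₆ + w + z`,
`‖𝔲(u)L(u+β_{j+1})L(u+β_{j+2})/L(u)‖ ≤ ((1+16e^{9/2}π²K²)(24K²+2K) + 128e^{9/2}πK³C₈₃ + 2e^{9/2}K²π)·Π̂²`
(comparison `Δ ≤ (…)Π̂²𝓛⁻¹⁵ ≤ (…)Π̂²` plus the model size `Π̂²·2e^{9/2}(1+𝓛)𝓛K²α/3 ≤ 2e^{9/2}K²π·Π̂²`, as
`(1+𝓛)𝓛α = (1+𝓛)π𝓛⁻⁸ ≤ 3π`... precisely `≤ π` for `𝓛 ≥ 3`). This is the `M` of the `ω₁`-removal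
`ShiftedContour.norm_circ_omega1_sub_le`. [cite: Zhang2022LandauSiegel, §12 proof of Lemma 12.2, p. 69; §5 Lemma 5.8] -/
theorem norm_true_on_shifted_sphere_le [NeZero D] (χ : DirichletCharacter ℂ D) (c' : ℝ)
    (hprim : χ.IsPrimitive) (h𝓛 : 3 ≤ Real.log D)
    (hA : ‖χ.LFunction 1‖ ≤ 1 / Real.log D ^ 2022) (j : ℕ) {d r : ℕ} (hd : d ≠ 0) (hr : r ≠ 0)
    (U : ℂ → ℂ) {C₈₃ K ℓ₀ : ℝ} (hC₈₃ : 0 ≤ C₈₃) (hK : 7 + 15 * |c'| ≤ K)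
    (hKL : K * π ≤ Real.log D ^ 8) (hℓ₀ : 0 < ℓ₀) (hℓ : ℓ₀ ≤ ‖deriv χ.LFunction 1‖)
    (hE : (1 + 16 * Real.exp (9 / 2) * π ^ 2 * K ^ 2) / Real.log D ^ 15 ≤ ℓ₀ * alpha D / 4)
    (hU3 : ∀ s : ℂ, ‖s - 1‖ ≤ 5 * alpha D → ‖U s - PiW χ d r‖ ≤
      C₈₃ * (ell D ^ 8)⁻¹ * ∏ q ∈ (d * r).primeFactors, (1 - (q : ℝ)⁻¹)⁻¹)
    {w : ℂ} (hw : ‖w‖ = alpha D) {z : ℂ} (hz : z ∈ sphere (beta6 D - w) (3 * alpha D)) :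
    ‖U (1 - beta6 D + w + z) * χ.LFunction (1 - beta6 D + w + z + betaJ c' D (j + 1)) *
        χ.LFunction (1 - beta6 D + w + z + betaJ c' D (j + 2)) / χ.LFunction (1 - beta6 D + w + z)‖ ≤
      ((1 + 16 * Real.exp (9 / 2) * π ^ 2 * K ^ 2) * (24 * K ^ 2 + 2 * K) +
          128 * Real.exp (9 / 2) * π * K ^ 3 * C₈₃ + 2 * Real.exp (9 / 2) * K ^ 2 * π) *
        (∏ q ∈ (d * r).primeFactors, (1 - (q : ℝ)⁻¹)⁻¹) ^ 2 := by
  set hatPi : ℝ := ∏ q ∈ (d * r).primeFactors, (1 - (q : ℝ)⁻¹)⁻¹ with hhatPi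
  set L : ℝ := Real.log D with hLdef
  have hℓ1 : 1 ≤ ell D := by rw [ell]; linarith
  have hL1 : 1 ≤ L := by linarith
  have hL0 : 0 < L := by linarith
  have hα : 0 < alpha D := alpha_pos' (by linarith)
  have hK0 : 0 ≤ K := by linarith [abs_nonneg c']
  have hP1 : 1 ≤ hatPi := one_le_hatPi' (d * r)
  have hP2 : 0 ≤ hatPi ^ 2 := by positivity
  -- comparison with the model, `Δ ≤ (…)·Π̂²/𝓛¹⁵`
  have hΔ := (norm_quot_sub_model_on_shifted_sphere χ c' hprim h𝓛 hA j hd hr U hC₈₃ hK hKL hℓ₀ hℓ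
      hE hU3 hw hz).trans (delta_le (by linarith : 1 ≤ Real.log D) hK0 hC₈₃ (d * r))
  -- the model size
  have hM := norm_model_on_shifted_sphere_le χ c' hprim h𝓛 j hd hr hK hw hz
  -- `(…)/𝓛¹⁵ ≤ (…)` and `(1+𝓛)𝓛·K²α/3 ≤ K²π` (`α = π/𝓛⁹`)
  have hαeq : alpha D = π / L ^ 9 := alpha_eq D
  have h15 : ((1 + 16 * Real.exp (9 / 2) * π ^ 2 * K ^ 2) * (24 * K ^ 2 + 2 * K) +
        128 * Real.exp (9 / 2) * π * K ^ 3 * C₈₃) * hatPi ^ 2 / L ^ 15 ≤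
      ((1 + 16 * Real.exp (9 / 2) * π ^ 2 * K ^ 2) * (24 * K ^ 2 + 2 * K) +
        128 * Real.exp (9 / 2) * π * K ^ 3 * C₈₃) * hatPi ^ 2 := by
    refine div_le_self (by positivity) (one_le_pow₀ hL1)
  have hmod : hatPi ^ 2 * (2 * Real.exp (9 / 2) * (1 + L) * L) * (K ^ 2 * alpha D / 3) ≤
      2 * Real.exp (9 / 2) * K ^ 2 * π * hatPi ^ 2 := by
    rw [hαeq]
    have hkey : (1 + L) * L * (π / L ^ 9) / 3 ≤ π := by
      rw [div_le_iff₀ (by norm_num : (0 : ℝ) < 3)]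
      have hL9 : (1 + L) * L ≤ 3 * L ^ 9 := by
        have h2 : (1 + L) * L ≤ 2 * L ^ 2 := by nlinarith
        have h3 : L ^ 2 ≤ L ^ 9 := pow_le_pow_right₀ hL1 (by norm_num)
        nlinarith
      calc (1 + L) * L * (π / L ^ 9) = ((1 + L) * L / L ^ 9) * π := by ring
        _ ≤ 3 * π := by
            refine mul_le_mul_of_nonneg_right ?_ Real.pi_pos.le
            rw [div_le_iff₀ (by positivity)]
            exact hL9
        _ = π * 3 := by ring
    have e : hatPi ^ 2 * (2 * Real.exp (9 / 2) * (1 + L) * L) * (K ^ 2 * (π / L ^ 9) / 3) =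
        2 * Real.exp (9 / 2) * K ^ 2 * hatPi ^ 2 * ((1 + L) * L * (π / L ^ 9) / 3) := by ring
    rw [e]
    calc 2 * Real.exp (9 / 2) * K ^ 2 * hatPi ^ 2 * ((1 + L) * L * (π / L ^ 9) / 3)
        ≤ 2 * Real.exp (9 / 2) * K ^ 2 * hatPi ^ 2 * π :=
          mul_le_mul_of_nonneg_left hkey (by positivity)
      _ = 2 * Real.exp (9 / 2) * K ^ 2 * π * hatPi ^ 2 := by ring
  -- triangle inequality
  have htri := norm_le_norm_add_norm_sub'
    (U (1 - beta6 D + w + z) * χ.LFunction (1 - beta6 D + w + z + betaJ c' D (j + 1)) *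
        χ.LFunction (1 - beta6 D + w + z + betaJ c' D (j + 2)) / χ.LFunction (1 - beta6 D + w + z))
    (PiW χ d r * deriv χ.LFunction 1 * (z + w - beta6 D + betaJ c' D (j + 1)) *
        (z + w - beta6 D + betaJ c' D (j + 2)) / (z + w - beta6 D))
  have hsum : ‖PiW χ d r * deriv χ.LFunction 1 * (z + w - beta6 D + betaJ c' D (j + 1)) *
          (z + w - beta6 D + betaJ c' D (j + 2)) / (z + w - beta6 D)‖ +
        ‖U (1 - beta6 D + w + z) * χ.LFunction (1 - beta6 D + w + z + betaJ c' D (j + 1)) *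
            χ.LFunction (1 - beta6 D + w + z + betaJ c' D (j + 2)) /
            χ.LFunction (1 - beta6 D + w + z) -
          PiW χ d r * deriv χ.LFunction 1 * (z + w - beta6 D + betaJ c' D (j + 1)) *
            (z + w - beta6 D + betaJ c' D (j + 2)) / (z + w - beta6 D)‖ ≤
      2 * Real.exp (9 / 2) * K ^ 2 * π * hatPi ^ 2 +
        ((1 + 16 * Real.exp (9 / 2) * π ^ 2 * K ^ 2) * (24 * K ^ 2 + 2 * K) +
          128 * Real.exp (9 / 2) * π * K ^ 3 * C₈₃) * hatPi ^ 2 :=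
    add_le_add (hM.trans hmod) (hΔ.trans h15)
  refine (htri.trans hsum).trans (le_of_eq ?_)
  ring

/-- **The TRUE quotient is continuous on the circle `|z − (β₆ − w)| = 3α`** (`u = 1 − β₆ + w + z`,
`Re u ≥ 1 − 11α/2 > 9/10` for `α < 1/30`; `𝔲` holomorphic on `σ > 9/10` (Lemma 8.3 (i)), `L(·,χ)` entire
(`χ ≠ χ₀`), `L(u,χ) ≠ 0` on the circle) — the hypothesis `hΦc` of `ShiftedContour.norm_circ_omega1_sub_le`.
[cite: Zhang2022LandauSiegel, §12 proof of Lemma 12.2, p. 69; §8 Lemma 8.3 (i)] -/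
theorem continuousOn_true_on_shifted_sphere [NeZero D] (χ : DirichletCharacter ℂ D) (hχ : χ ≠ 1)
    (c' : ℝ) (j : ℕ) (hα : 0 < alpha D) (hα30 : alpha D < 1 / 30) {w : ℂ} (hw : ‖w‖ = alpha D)
    (U : ℂ → ℂ) (hUd : DifferentiableOn ℂ U {s : ℂ | 9 / 10 < s.re})
    (hLnz : ∀ z ∈ sphere (beta6 D - w) (3 * alpha D), χ.LFunction (1 - beta6 D + w + z) ≠ 0) :
    ContinuousOn (fun z : ℂ => U (1 - beta6 D + w + z) *
        χ.LFunction (1 - beta6 D + w + z + betaJ c' D (j + 1)) *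
        χ.LFunction (1 - beta6 D + w + z + betaJ c' D (j + 2)) / χ.LFunction (1 - beta6 D + w + z))
      (sphere (beta6 D - w) (3 * alpha D)) := by
  have hLc : Continuous fun s : ℂ => χ.LFunction s :=
    (DirichletCharacter.differentiable_LFunction hχ).continuous
  have hO : IsOpen {s : ℂ | 9 / 10 < s.re} := isOpen_lt continuous_const Complex.continuous_re
  intro z hz
  obtain ⟨hn, -, -, -⟩ := sphere_shift_bounds hα hw hz
  have hre : 9 / 10 < (1 - beta6 D + w + z).re := by
    have hr : |(z + w - beta6 D).re| ≤ 3 * alpha D := (Complex.abs_re_le_norm _).trans hn.le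
    have e : (1 - beta6 D + w + z).re = 1 + (z + w - beta6 D).re := by
      simp only [Complex.add_re, Complex.sub_re, Complex.one_re]; ring
    rw [e]
    have := (abs_le.mp hr).1
    linarith
  have hUc : ContinuousAt (fun z : ℂ => U (1 - beta6 D + w + z)) z := by
    have hUat : ContinuousAt U (1 - beta6 D + w + z) :=
      (hUd.differentiableAt (hO.mem_nhds hre)).continuousAt
    exact hUat.comp (by fun_prop)
  refine ContinuousAt.continuousWithinAt ?_
  refine ContinuousAt.div ?_ (hLc.continuousAt.comp (by fun_prop)) (hLnz z hz)
  exact (hUc.mul (hLc.continuousAt.comp (by fun_prop))).mul (hLc.continuousAt.comp (by fun_prop))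


/-! ## The one-call evaluation of the `ω₁`-circle -/

/-- `log P · α = π` (`α = π/log P`). [cite: Zhang2022LandauSiegel, §2 (2.3)] -/
private theorem log_bigP_mul_alpha' (hL : 1 ≤ ell D) : Real.log (bigP D) * alpha D = π := by
  have hlog : Real.log (bigP D) = ell D ^ 9 := by rw [bigP, Real.log_exp]
  have h9 : ell D ^ 9 ≠ 0 := pow_ne_zero _ (by linarith)
  rw [alpha, hlog]
  field_simp

/-- For `1 ≤ Y ≤ P` and `t ≤ 11α/2`: `Y^t ≤ P^{11α/2} = e^{11π/2}`. [cite: Zhang2022LandauSiegel, §12 proof of Lemma 12.2, p. 69] -/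
private theorem rpow_le_exp_of_le (hL : 1 ≤ ell D) {Y : ℝ} (hY : 1 ≤ Y) (hYP : Y ≤ bigP D) {t : ℝ}
    (ht : t ≤ 11 * alpha D / 2) : Y ^ t ≤ Real.exp (11 * π / 2) := by
  have hα : 0 < alpha D := alpha_pos' (by linarith)
  calc Y ^ t ≤ Y ^ (11 * alpha D / 2) := Real.rpow_le_rpow_of_exponent_le hY ht
    _ ≤ bigP D ^ (11 * alpha D / 2) := Real.rpow_le_rpow (by linarith) hYP (by positivity)
    _ = Real.exp (11 * π / 2) := by
        rw [Real.rpow_def_of_pos (bigP_pos D)]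
        congr 1
        have h := log_bigP_mul_alpha' (D := D) hL
        calc Real.log (bigP D) * (11 * alpha D / 2) = 11 * (Real.log (bigP D) * alpha D) / 2 := by ring
          _ = 11 * π / 2 := by rw [h]

/-- **The `ω₁`-glue on the circle `C(β₆−w,3α)` is `O(M·α²)`**: for `|w| = α` (`0 < α < 1/30`, `𝓛 ≥ 1`),
`1 ≤ Y ≤ P`, `Λ ≥ 1` and `M ≥ 0`, the right-hand side of `ShiftedContour.norm_circ_omega1_sub_le` at
`c = β₆ − w`, `R = 3α` is at most `(363/4)e^{11π/2}·M·α²` (`‖c‖ + R ≤ 11α/2`, `R − ‖c‖ ≥ α/2`,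
`Y^{‖c‖+R} ≤ e^{11π/2}`). [cite: Zhang2022LandauSiegel, §12 proof of Lemma 12.2, p. 69; §4 (4.1)] -/
theorem omega1_glue_le (hL : 1 ≤ ell D) {w : ℂ} (hw : ‖w‖ = alpha D)
    {Y : ℝ} (hY : 1 ≤ Y) (hYP : Y ≤ bigP D) {Λ : ℝ} (hΛ : 1 ≤ Λ) {M : ℝ} (hM : 0 ≤ M) :
    3 * alpha D * (M * Y ^ (‖beta6 D - w‖ + 3 * alpha D) *
        (2 * ((‖beta6 D - w‖ + 3 * alpha D) ^ 2 / (4 * Λ))) / (3 * alpha D - ‖beta6 D - w‖)) ≤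
      363 / 4 * Real.exp (11 * π / 2) * M * alpha D ^ 2 := by
  have hα : 0 < alpha D := alpha_pos' (by linarith)
  obtain ⟨-, hc52, hc3⟩ := center_shift_bounds hα hw
  set nc : ℝ := ‖beta6 D - w‖ with hnc
  have hsum : nc + 3 * alpha D ≤ 11 * alpha D / 2 := by linarith
  have hdiff : alpha D / 2 ≤ 3 * alpha D - nc := by linarith
  have hdiff0 : 0 < 3 * alpha D - nc := by linarith
  have hYc : Y ^ (nc + 3 * alpha D) ≤ Real.exp (11 * π / 2) := rpow_le_exp_of_le hL hY hYP hsum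
  have hfrac : 2 * ((nc + 3 * alpha D) ^ 2 / (4 * Λ)) ≤ 121 * alpha D ^ 2 / 8 := by
    have h1 : (nc + 3 * alpha D) ^ 2 ≤ (11 * alpha D / 2) ^ 2 :=
      pow_le_pow_left₀ (by positivity) hsum 2
    have h2 : (nc + 3 * alpha D) ^ 2 / (4 * Λ) ≤ (11 * alpha D / 2) ^ 2 / 4 := by
      calc (nc + 3 * alpha D) ^ 2 / (4 * Λ) ≤ (11 * alpha D / 2) ^ 2 / (4 * Λ) :=
            div_le_div_of_nonneg_right h1 (by positivity)
        _ ≤ (11 * alpha D / 2) ^ 2 / 4 := by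
            refine div_le_div_of_nonneg_left (by positivity) (by norm_num) (by linarith)
    have e : (11 * alpha D / 2) ^ 2 / 4 = 121 * alpha D ^ 2 / 16 := by ring
    rw [e] at h2
    linarith
  have hnum : M * Y ^ (nc + 3 * alpha D) * (2 * ((nc + 3 * alpha D) ^ 2 / (4 * Λ))) ≤
      M * Real.exp (11 * π / 2) * (121 * alpha D ^ 2 / 8) := by
    have h1 : M * Y ^ (nc + 3 * alpha D) ≤ M * Real.exp (11 * π / 2) :=
      mul_le_mul_of_nonneg_left hYc hM
    exact mul_le_mul h1 hfrac (by positivity) (by positivity)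
  have hnum0 : 0 ≤ M * Real.exp (11 * π / 2) * (121 * alpha D ^ 2 / 8) := by positivity
  calc 3 * alpha D * (M * Y ^ (nc + 3 * alpha D) * (2 * ((nc + 3 * alpha D) ^ 2 / (4 * Λ))) /
          (3 * alpha D - nc))
      ≤ 3 * alpha D * (M * Real.exp (11 * π / 2) * (121 * alpha D ^ 2 / 8) / (alpha D / 2)) := by
        refine mul_le_mul_of_nonneg_left ?_ (by positivity)
        calc M * Y ^ (nc + 3 * alpha D) * (2 * ((nc + 3 * alpha D) ^ 2 / (4 * Λ))) / (3 * alpha D - nc)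
            ≤ M * Real.exp (11 * π / 2) * (121 * alpha D ^ 2 / 8) / (3 * alpha D - nc) :=
              div_le_div_of_nonneg_right hnum hdiff0.le
          _ ≤ M * Real.exp (11 * π / 2) * (121 * alpha D ^ 2 / 8) / (alpha D / 2) :=
              div_le_div_of_nonneg_left hnum0 (by positivity) hdiff
    _ = 363 / 4 * Real.exp (11 * π / 2) * M * alpha D ^ 2 := by
        field_simp
        ring

/-- **The small circle WITH `ω₁`, kernel `Y^zω₁(z)/z`, in one call** (`Z22:§12.u030`; the circle term of
`ShiftedContour.norm_vline_sub_circ_le` at `c = β₆ − w`, `R = 3α`, evaluated). For `χ` primitive, `χ ≠ χ₀`,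
`𝓛 = log D ≥ 3`, (A) `‖L(1,χ)‖ ≤ 𝓛⁻²⁰²²`, `α < 1/30`, `K ≥ 7 + 15|c′|` with `Kπ ≤ 𝓛⁸`, `0 < ℓ₀ ≤ |L′(1,χ)|`
with `(1+16e^{9/2}π²K²)𝓛⁻¹⁵ ≤ ℓ₀α/4`, `𝔲` holomorphic on `σ > 9/10` with `‖𝔲(u) − Π(d,r)‖ ≤ C₈₃𝓛⁻⁸Π̂` on
`|u−1| ≤ 5α` (Lemma 8.3 (i), (iii′)), `|w| = α`, `1 ≤ Y ≤ P` and `Λ ≥ 1` (the lane's `Λ = 𝓛³⁰`):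
`‖(2πi)⁻¹∮_{C(β₆−w,3α)} 𝔲(u)L(u+β_{j+1})L(u+β_{j+2})/L(u)·Y^{z+0}ω₁(z+0)/(z+0) dz
   − Π(d,r)L′(1,χ)·(w − β₆ + β_{j+1} + β_{j+2} + β_{j+1}β_{j+2}(Y^{β₆−w} − 1)/(β₆−w))‖
 ≤ (6e^{11π/2}·Δ₀ + (363/4)e^{11π/2}π²·M₀)·Π̂²·𝓛⁻¹⁵`, `Δ₀ = (1+16e^{9/2}π²K²)(24K²+2K) + 128e^{9/2}πK³C₈₃`,
`M₀ = Δ₀ + 2e^{9/2}K²π` (`u = 1 − β₆ + w + z`): `ω₁`-removal (`ShiftedContour.norm_circ_omega1_sub_le`, glue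
`(363/4)e^{11π/2}M₀Π̂²α² ≤ (363/4)e^{11π/2}π²M₀Π̂²𝓛⁻¹⁵`) + `Lemma84.norm_circ_true_sub_main_kernel1`. The value
subtracted is `Π L′(1,χ)·circ030` (`Typed.Sec12B.U031_holds`).
[cite: Zhang2022LandauSiegel, §12 proof of Lemma 12.3, p. 70, tex L3564–L3577] [cite: Zhang2022LandauSiegel, §4 (4.1)] -/
theorem norm_circ_omega1_true_sub_main_kernel1 [NeZero D] (χ : DirichletCharacter ℂ D) (c' : ℝ)
    (hprim : χ.IsPrimitive) (hχ : χ ≠ 1) (h𝓛 : 3 ≤ Real.log D)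
    (hA : ‖χ.LFunction 1‖ ≤ 1 / Real.log D ^ 2022) (hα30 : alpha D < 1 / 30)
    (j : ℕ) {d r : ℕ} (hd : d ≠ 0) (hr : r ≠ 0)
    (U : ℂ → ℂ) (hUd : DifferentiableOn ℂ U {s : ℂ | 9 / 10 < s.re})
    {C₈₃ K ℓ₀ : ℝ} (hC₈₃ : 0 ≤ C₈₃) (hK : 7 + 15 * |c'| ≤ K)
    (hKL : K * π ≤ Real.log D ^ 8) (hℓ₀ : 0 < ℓ₀) (hℓ : ℓ₀ ≤ ‖deriv χ.LFunction 1‖)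
    (hE : (1 + 16 * Real.exp (9 / 2) * π ^ 2 * K ^ 2) / Real.log D ^ 15 ≤ ℓ₀ * alpha D / 4)
    (hU3 : ∀ s : ℂ, ‖s - 1‖ ≤ 5 * alpha D → ‖U s - PiW χ d r‖ ≤
      C₈₃ * (ell D ^ 8)⁻¹ * ∏ q ∈ (d * r).primeFactors, (1 - (q : ℝ)⁻¹)⁻¹)
    {w : ℂ} (hw : ‖w‖ = alpha D) {Y : ℝ} (hY : 1 ≤ Y) (hYP : Y ≤ bigP D) {Λ : ℝ} (hΛ : 1 ≤ Λ) :
    ‖(2 * π * I)⁻¹ * (∮ z in C(beta6 D - w, 3 * alpha D),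
          U (1 - beta6 D + w + z) * χ.LFunction (1 - beta6 D + w + z + betaJ c' D (j + 1)) *
              χ.LFunction (1 - beta6 D + w + z + betaJ c' D (j + 2)) /
              χ.LFunction (1 - beta6 D + w + z) *
            (((Y : ℝ) : ℂ) ^ (z + 0) * omega1 Λ (z + 0) / (z + 0))) -
        PiW χ d r * deriv χ.LFunction 1 *
          (w - beta6 D + betaJ c' D (j + 1) + betaJ c' D (j + 2) +
            betaJ c' D (j + 1) * betaJ c' D (j + 2) *
              ((((Y : ℝ) : ℂ) ^ (beta6 D - w) - 1) / (beta6 D - w)))‖ ≤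
      (6 * Real.exp (11 * π / 2) *
            ((1 + 16 * Real.exp (9 / 2) * π ^ 2 * K ^ 2) * (24 * K ^ 2 + 2 * K) +
              128 * Real.exp (9 / 2) * π * K ^ 3 * C₈₃) +
          363 / 4 * Real.exp (11 * π / 2) * π ^ 2 *
            ((1 + 16 * Real.exp (9 / 2) * π ^ 2 * K ^ 2) * (24 * K ^ 2 + 2 * K) +
              128 * Real.exp (9 / 2) * π * K ^ 3 * C₈₃ + 2 * Real.exp (9 / 2) * K ^ 2 * π)) *
        (∏ q ∈ (d * r).primeFactors, (1 - (q : ℝ)⁻¹)⁻¹) ^ 2 / Real.log D ^ 15 := by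
  set hatPi : ℝ := ∏ q ∈ (d * r).primeFactors, (1 - (q : ℝ)⁻¹)⁻¹ with hhatPi
  set L : ℝ := Real.log D with hLdef
  set Δ₀ : ℝ := (1 + 16 * Real.exp (9 / 2) * π ^ 2 * K ^ 2) * (24 * K ^ 2 + 2 * K) +
      128 * Real.exp (9 / 2) * π * K ^ 3 * C₈₃ with hΔ₀
  set M₀ : ℝ := (1 + 16 * Real.exp (9 / 2) * π ^ 2 * K ^ 2) * (24 * K ^ 2 + 2 * K) +
      128 * Real.exp (9 / 2) * π * K ^ 3 * C₈₃ + 2 * Real.exp (9 / 2) * K ^ 2 * π with hM₀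
  -- the true quotient as a function of `z`
  set Φ : ℂ → ℂ := fun z => U (1 - beta6 D + w + z) *
      χ.LFunction (1 - beta6 D + w + z + betaJ c' D (j + 1)) *
      χ.LFunction (1 - beta6 D + w + z + betaJ c' D (j + 2)) / χ.LFunction (1 - beta6 D + w + z)
    with hΦdef
  have hℓ1 : 1 ≤ ell D := by rw [ell]; linarith
  have hL1 : 1 ≤ L := by linarith
  have hL0 : 0 < L := by linarith
  have hα : 0 < alpha D := alpha_pos' (by linarith)
  have hK0 : 0 ≤ K := by linarith [abs_nonneg c']
  have hK3 : 3 ≤ K := by linarith [abs_nonneg c']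
  have hP1 : 1 ≤ hatPi := one_le_hatPi' (d * r)
  have hΔ₀0 : 0 ≤ Δ₀ := by positivity
  have hM₀0 : 0 ≤ M₀ := by positivity
  obtain ⟨hc0, hc52, hc3⟩ := center_shift_bounds hα hw
  -- data of the `ω₁`-removal lemma
  have hLnz : ∀ z ∈ sphere (beta6 D - w) (3 * alpha D), χ.LFunction (1 - beta6 D + w + z) ≠ 0 :=
    fun z hz => (LFunction_ne_zero_on_shifted_sphere χ hprim h𝓛 hA hK3 hKL hℓ₀ hℓ hE hw hz).2
  have hΦc : ContinuousOn Φ (sphere (beta6 D - w) (3 * alpha D)) :=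
    continuousOn_true_on_shifted_sphere χ hχ c' j hα hα30 hw U hUd hLnz
  have hMb : ∀ z ∈ sphere (beta6 D - w) (3 * alpha D), ‖Φ z‖ ≤ M₀ * hatPi ^ 2 := fun z hz =>
    norm_true_on_shifted_sphere_le χ c' hprim h𝓛 hA j hd hr U hC₈₃ hK hKL hℓ₀ hℓ hE hU3 hw hz
  have hsmall : (‖beta6 D - w‖ + 3 * alpha D) ^ 2 ≤ 4 * Λ := by
    have h1 : ‖beta6 D - w‖ + 3 * alpha D ≤ 1 := by linarith
    have h2 : (‖beta6 D - w‖ + 3 * alpha D) ^ 2 ≤ 1 ^ 2 := pow_le_pow_left₀ (by positivity) h1 2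
    linarith
  have hglue := ShiftedContour.norm_circ_omega1_sub_le (Y := Y) (by linarith : (0 : ℝ) < Λ) hY hc3
    hsmall hΦc hMb
  have hglue' := hglue.trans
    (omega1_glue_le hℓ1 hw hY hYP hΛ (by positivity : 0 ≤ M₀ * hatPi ^ 2))
  -- the bare-kernel evaluation
  have hbare := norm_circ_true_sub_main_kernel1 χ c' hprim hχ h𝓛 hA hα30 j hd hr U hUd hC₈₃ hK hKL hℓ₀
    hℓ hE hU3 hw hY hYP
  -- triangle inequality
  have htri := norm_sub_le_norm_sub_add_norm_sub
    ((2 * π * I)⁻¹ * (∮ z in C(beta6 D - w, 3 * alpha D),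
      Φ z * (((Y : ℝ) : ℂ) ^ (z + 0) * omega1 Λ (z + 0) / (z + 0))))
    ((2 * π * I)⁻¹ * (∮ z in C(beta6 D - w, 3 * alpha D), Φ z * (((Y : ℝ) : ℂ) ^ z / z)))
    (PiW χ d r * deriv χ.LFunction 1 *
      (w - beta6 D + betaJ c' D (j + 1) + betaJ c' D (j + 2) +
        betaJ c' D (j + 1) * betaJ c' D (j + 2) *
          ((((Y : ℝ) : ℂ) ^ (beta6 D - w) - 1) / (beta6 D - w))))
  -- `α² ≤ π²/𝓛¹⁵`
  have hαeq : alpha D = π / L ^ 9 := alpha_eq D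
  have hα2 : alpha D ^ 2 ≤ π ^ 2 / L ^ 15 := by
    rw [hαeq, div_pow]
    have h : L ^ 15 ≤ (L ^ 9) ^ 2 := by
      rw [← pow_mul]
      exact pow_le_pow_right₀ hL1 (by norm_num)
    exact div_le_div_of_nonneg_left (by positivity) (by positivity) h
  have hglue'' : 363 / 4 * Real.exp (11 * π / 2) * (M₀ * hatPi ^ 2) * alpha D ^ 2 ≤
      363 / 4 * Real.exp (11 * π / 2) * π ^ 2 * M₀ * hatPi ^ 2 / L ^ 15 := by
    calc 363 / 4 * Real.exp (11 * π / 2) * (M₀ * hatPi ^ 2) * alpha D ^ 2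
        ≤ 363 / 4 * Real.exp (11 * π / 2) * (M₀ * hatPi ^ 2) * (π ^ 2 / L ^ 15) :=
          mul_le_mul_of_nonneg_left hα2 (by positivity)
      _ = _ := by ring
  have hbare' : ‖(2 * π * I)⁻¹ * (∮ z in C(beta6 D - w, 3 * alpha D), Φ z * (((Y : ℝ) : ℂ) ^ z / z)) -
        PiW χ d r * deriv χ.LFunction 1 *
          (w - beta6 D + betaJ c' D (j + 1) + betaJ c' D (j + 2) +
            betaJ c' D (j + 1) * betaJ c' D (j + 2) *
              ((((Y : ℝ) : ℂ) ^ (beta6 D - w) - 1) / (beta6 D - w)))‖ ≤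
      6 * Real.exp (11 * π / 2) * (Δ₀ * hatPi ^ 2 / L ^ 15) := hbare
  have hfin : 363 / 4 * Real.exp (11 * π / 2) * π ^ 2 * M₀ * hatPi ^ 2 / L ^ 15 +
        6 * Real.exp (11 * π / 2) * (Δ₀ * hatPi ^ 2 / L ^ 15) =
      (6 * Real.exp (11 * π / 2) * Δ₀ + 363 / 4 * Real.exp (11 * π / 2) * π ^ 2 * M₀) *
        hatPi ^ 2 / L ^ 15 := by ring
  rw [← hfin]
  exact htri.trans (add_le_add (hglue'.trans hglue'') hbare')

/-- **The small circle WITH `ω₁`, u025 form (pair of lengths `Y₂`, `Y₁`)**: under the same hypotheses with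
`1 ≤ Y₁, Y₂ ≤ P`, the DIFFERENCE of the two `ω₁`-circle integrals is
`Π(d,r)L′(1,χ)·β_{j+1}β_{j+2}(Y₂^{β₆−w} − Y₁^{β₆−w})/(β₆−w)` up to twice the error of
`norm_circ_omega1_true_sub_main_kernel1` — the value is `Π L′(1,χ)·circ025` (`Typed.Sec12B.circ025_eq`), and the
two circle terms are LITERALLY those of `ShiftedContour.norm_vline_sub_circ_le` at `Y = P″₂/dr`, `P″₁/dr`,
whose line integrals differ by `lineInt024` (`Z22:§12.u025`, p. 69, tex L3534).
[cite: Zhang2022LandauSiegel, §12 proof of Lemma 12.2, p. 69, tex L3534] [cite: Zhang2022LandauSiegel, §4 (4.1)] -/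
theorem norm_circ_omega1_pair_sub_main [NeZero D] (χ : DirichletCharacter ℂ D) (c' : ℝ)
    (hprim : χ.IsPrimitive) (hχ : χ ≠ 1) (h𝓛 : 3 ≤ Real.log D)
    (hA : ‖χ.LFunction 1‖ ≤ 1 / Real.log D ^ 2022) (hα30 : alpha D < 1 / 30)
    (j : ℕ) {d r : ℕ} (hd : d ≠ 0) (hr : r ≠ 0)
    (U : ℂ → ℂ) (hUd : DifferentiableOn ℂ U {s : ℂ | 9 / 10 < s.re})
    {C₈₃ K ℓ₀ : ℝ} (hC₈₃ : 0 ≤ C₈₃) (hK : 7 + 15 * |c'| ≤ K)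
    (hKL : K * π ≤ Real.log D ^ 8) (hℓ₀ : 0 < ℓ₀) (hℓ : ℓ₀ ≤ ‖deriv χ.LFunction 1‖)
    (hE : (1 + 16 * Real.exp (9 / 2) * π ^ 2 * K ^ 2) / Real.log D ^ 15 ≤ ℓ₀ * alpha D / 4)
    (hU3 : ∀ s : ℂ, ‖s - 1‖ ≤ 5 * alpha D → ‖U s - PiW χ d r‖ ≤
      C₈₃ * (ell D ^ 8)⁻¹ * ∏ q ∈ (d * r).primeFactors, (1 - (q : ℝ)⁻¹)⁻¹)
    {w : ℂ} (hw : ‖w‖ = alpha D) {Y₁ Y₂ : ℝ} (hY₁ : 1 ≤ Y₁) (hY₁P : Y₁ ≤ bigP D)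
    (hY₂ : 1 ≤ Y₂) (hY₂P : Y₂ ≤ bigP D) {Λ : ℝ} (hΛ : 1 ≤ Λ) :
    ‖((2 * π * I)⁻¹ * (∮ z in C(beta6 D - w, 3 * alpha D),
          U (1 - beta6 D + w + z) * χ.LFunction (1 - beta6 D + w + z + betaJ c' D (j + 1)) *
              χ.LFunction (1 - beta6 D + w + z + betaJ c' D (j + 2)) /
              χ.LFunction (1 - beta6 D + w + z) *
            (((Y₂ : ℝ) : ℂ) ^ (z + 0) * omega1 Λ (z + 0) / (z + 0))) -
        (2 * π * I)⁻¹ * (∮ z in C(beta6 D - w, 3 * alpha D),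
          U (1 - beta6 D + w + z) * χ.LFunction (1 - beta6 D + w + z + betaJ c' D (j + 1)) *
              χ.LFunction (1 - beta6 D + w + z + betaJ c' D (j + 2)) /
              χ.LFunction (1 - beta6 D + w + z) *
            (((Y₁ : ℝ) : ℂ) ^ (z + 0) * omega1 Λ (z + 0) / (z + 0)))) -
        PiW χ d r * deriv χ.LFunction 1 *
          (betaJ c' D (j + 1) * betaJ c' D (j + 2) *
            ((((Y₂ : ℝ) : ℂ) ^ (beta6 D - w) - ((Y₁ : ℝ) : ℂ) ^ (beta6 D - w)) / (beta6 D - w)))‖ ≤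
      2 * ((6 * Real.exp (11 * π / 2) *
            ((1 + 16 * Real.exp (9 / 2) * π ^ 2 * K ^ 2) * (24 * K ^ 2 + 2 * K) +
              128 * Real.exp (9 / 2) * π * K ^ 3 * C₈₃) +
          363 / 4 * Real.exp (11 * π / 2) * π ^ 2 *
            ((1 + 16 * Real.exp (9 / 2) * π ^ 2 * K ^ 2) * (24 * K ^ 2 + 2 * K) +
              128 * Real.exp (9 / 2) * π * K ^ 3 * C₈₃ + 2 * Real.exp (9 / 2) * K ^ 2 * π)) *
        (∏ q ∈ (d * r).primeFactors, (1 - (q : ℝ)⁻¹)⁻¹) ^ 2 / Real.log D ^ 15) := by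
  have h₂ := norm_circ_omega1_true_sub_main_kernel1 χ c' hprim hχ h𝓛 hA hα30 j hd hr U hUd hC₈₃ hK hKL
    hℓ₀ hℓ hE hU3 hw hY₂ hY₂P hΛ
  have h₁ := norm_circ_omega1_true_sub_main_kernel1 χ c' hprim hχ h𝓛 hA hα30 j hd hr U hUd hC₈₃ hK hKL
    hℓ₀ hℓ hE hU3 hw hY₁ hY₁P hΛ
  -- abbreviate the three values
  set A₂ := (2 * π * I)⁻¹ * (∮ z in C(beta6 D - w, 3 * alpha D),
      U (1 - beta6 D + w + z) * χ.LFunction (1 - beta6 D + w + z + betaJ c' D (j + 1)) *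
          χ.LFunction (1 - beta6 D + w + z + betaJ c' D (j + 2)) / χ.LFunction (1 - beta6 D + w + z) *
        (((Y₂ : ℝ) : ℂ) ^ (z + 0) * omega1 Λ (z + 0) / (z + 0))) with hA₂
  set A₁ := (2 * π * I)⁻¹ * (∮ z in C(beta6 D - w, 3 * alpha D),
      U (1 - beta6 D + w + z) * χ.LFunction (1 - beta6 D + w + z + betaJ c' D (j + 1)) *
          χ.LFunction (1 - beta6 D + w + z + betaJ c' D (j + 2)) / χ.LFunction (1 - beta6 D + w + z) *
        (((Y₁ : ℝ) : ℂ) ^ (z + 0) * omega1 Λ (z + 0) / (z + 0))) with hA₁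
  set ellPi : ℂ := PiW χ d r * deriv χ.LFunction 1 with hellPi
  set βa : ℂ := betaJ c' D (j + 1) with hβa
  set βb : ℂ := betaJ c' D (j + 2) with hβb
  set M₂ : ℂ := ellPi * (w - beta6 D + βa + βb + βa * βb * ((((Y₂ : ℝ) : ℂ) ^ (beta6 D - w) - 1) /
      (beta6 D - w))) with hM₂
  set M₁ : ℂ := ellPi * (w - beta6 D + βa + βb + βa * βb * ((((Y₁ : ℝ) : ℂ) ^ (beta6 D - w) - 1) /
      (beta6 D - w))) with hM₁
  have e : A₂ - A₁ - ellPi * (βa * βb * ((((Y₂ : ℝ) : ℂ) ^ (beta6 D - w) -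
      ((Y₁ : ℝ) : ℂ) ^ (beta6 D - w)) / (beta6 D - w))) = (A₂ - M₂) - (A₁ - M₁) := by
    rw [hM₂, hM₁]
    ring
  rw [e]
  refine (norm_sub_le _ _).trans ?_
  linarith [h₂, h₁]


/-! ## The same two evaluations under the lane's standing quantifier (all numerical side conditions inside) -/

/-- A threshold `D₀` beyond which `log D ≥ M`. [folklore] -/
private theorem exists_nat_le_log' (M : ℝ) : ∃ D₀ : ℕ, ∀ D : ℕ, D₀ ≤ D → M ≤ Real.log D := by
  refine ⟨⌈Real.exp M⌉₊ + 1, fun D hD => ?_⟩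
  have h1 : Real.exp M ≤ D := by
    have : (⌈Real.exp M⌉₊ : ℝ) + 1 ≤ D := by exact_mod_cast hD
    linarith [Nat.le_ceil (Real.exp M)]
  have hD0 : (0 : ℝ) < D := lt_of_lt_of_le (Real.exp_pos M) h1
  rw [Real.le_log_iff_exp_le hD0]
  exact h1

/-- **The `ω₁`-circle evaluation, packaged** (kernel `Y^zω₁(z)/z`; `Z22:§12.u030` and, twice, `u025`): for
every `c′` and every real `C₈₃` there are `C ≥ 0` and `D₀` such that for `D ≥ D₀`, `χ` real primitive mod `D`
with (A), every `j`, `d, r ≥ 1`, every `𝔲` holomorphic on `σ > 9/10` with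
`‖𝔲(u) − Π(d,r)‖ ≤ C₈₃𝓛⁻⁸Π̂` on `|u − 1| ≤ 5α` (the clauses (i), (iii′) of `Skeleton.Lemma83Rel`, a theorem of the
tree), every `|w| = α`, `1 ≤ Y ≤ P` and `Λ ≥ 1`:
`‖(2πi)⁻¹∮_{C(β₆−w,3α)} 𝔲(u)L(u+β_{j+1})L(u+β_{j+2})/L(u)·Y^{z+0}ω₁ Λ (z+0)/(z+0) dz
   − Π(d,r)L′(1,χ)·(w − β₆ + β_{j+1} + β_{j+2} + β_{j+1}β_{j+2}(Y^{β₆−w} − 1)/(β₆−w))‖ ≤ C·𝓛⁻¹⁵·Π̂²`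
— `norm_circ_omega1_true_sub_main_kernel1` with `K = 7 + 15|c′|`, `ℓ₀ = e⁻¹/4 ≤ |L′(1,χ)|` (Lemma 5.7,
`Lemma57.lemma_5_7`), `Kπ ≤ 𝓛 ≤ 𝓛⁸`, `4(1+16e^{9/2}π²K²)/(ℓ₀π) ≤ 𝓛`, `α = π𝓛⁻⁹ < 1/30`, `𝓛 ≥ 3`, and `C₈₃`
replaced by `|C₈₃|`. [cite: Zhang2022LandauSiegel, §12 proof of Lemma 12.3, p. 70, tex L3564] [cite: Zhang2022LandauSiegel, §5 Lemma 5.7] -/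
theorem circ_omega1_eval_forAllLarge (c' C₈₃ : ℝ) :
    ∃ C : ℝ, 0 ≤ C ∧ ForAllLarge fun D _ χ => AssumptionA D χ →
      ∀ j : ℕ, ∀ d r : ℕ, d ≠ 0 → r ≠ 0 → ∀ U : ℂ → ℂ,
        DifferentiableOn ℂ U {s : ℂ | 9 / 10 < s.re} →
        (∀ s : ℂ, ‖s - 1‖ ≤ 5 * alpha D → ‖U s - PiW χ d r‖ ≤
            C₈₃ * (ell D ^ 8)⁻¹ * ∏ q ∈ (d * r).primeFactors, (1 - (q : ℝ)⁻¹)⁻¹) →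
        ∀ w : ℂ, ‖w‖ = alpha D → ∀ Y : ℝ, 1 ≤ Y → Y ≤ bigP D → ∀ Λ : ℝ, 1 ≤ Λ →
          ‖(2 * π * I)⁻¹ * (∮ z in C(beta6 D - w, 3 * alpha D),
                U (1 - beta6 D + w + z) * χ.LFunction (1 - beta6 D + w + z + betaJ c' D (j + 1)) *
                    χ.LFunction (1 - beta6 D + w + z + betaJ c' D (j + 2)) /
                    χ.LFunction (1 - beta6 D + w + z) *
                  (((Y : ℝ) : ℂ) ^ (z + 0) * omega1 Λ (z + 0) / (z + 0))) -
              PiW χ d r * deriv χ.LFunction 1 *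
                (w - beta6 D + betaJ c' D (j + 1) + betaJ c' D (j + 2) +
                  betaJ c' D (j + 1) * betaJ c' D (j + 2) *
                    ((((Y : ℝ) : ℂ) ^ (beta6 D - w) - 1) / (beta6 D - w)))‖ ≤
            C * (ell D ^ 15)⁻¹ * (∏ q ∈ (d * r).primeFactors, (1 - (q : ℝ)⁻¹)⁻¹) ^ 2 := by
  obtain ⟨L₅₇, h57⟩ := Lemma57.lemma_5_7
  set Cabs : ℝ := |C₈₃| with hCabs
  have hCabs0 : 0 ≤ Cabs := abs_nonneg _
  set K : ℝ := 7 + 15 * |c'| with hKdef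
  have hK0 : 0 ≤ K := by rw [hKdef]; positivity
  set C₅ : ℝ := 1 + 16 * Real.exp (9 / 2) * π ^ 2 * K ^ 2 with hC₅
  set ℓ₀ : ℝ := Real.exp (-1) / 4 with hℓ₀
  have hℓ₀0 : 0 < ℓ₀ := by positivity
  set Cfin : ℝ := 6 * Real.exp (11 * π / 2) * (C₅ * (24 * K ^ 2 + 2 * K) +
        128 * Real.exp (9 / 2) * π * K ^ 3 * Cabs) +
      363 / 4 * Real.exp (11 * π / 2) * π ^ 2 * (C₅ * (24 * K ^ 2 + 2 * K) +
        128 * Real.exp (9 / 2) * π * K ^ 3 * Cabs + 2 * Real.exp (9 / 2) * K ^ 2 * π) with hCfin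
  refine ⟨Cfin, by positivity, ?_⟩
  set Lmax : ℝ := max (max 3 L₅₇) (max (K * π) (4 * C₅ / (ℓ₀ * π))) with hLmax
  obtain ⟨D₂, hD₂⟩ := exists_nat_le_log' Lmax
  refine ⟨D₂, fun D _ χ hD hq hp hA j d r hd hr U hUd hU3 w hw Y hY hYP Λ hΛ => ?_⟩
  have hLm : Lmax ≤ Real.log D := hD₂ D hD
  set 𝓛 : ℝ := Real.log D with h𝓛def
  have h𝓛3 : 3 ≤ 𝓛 := le_trans (by simp [hLmax]) hLm
  have hL57 : L₅₇ ≤ 𝓛 := le_trans (by simp [hLmax]) hLm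
  have hLKπ : K * π ≤ 𝓛 := le_trans (by simp [hLmax]) hLm
  have hLC₅ : 4 * C₅ / (ℓ₀ * π) ≤ 𝓛 := le_trans (by simp [hLmax]) hLm
  have h𝓛1 : 1 ≤ 𝓛 := by linarith
  have hπ0 := Real.pi_pos
  -- `D ≥ 2`, `χ ≠ 1`
  have hD0 : (0 : ℝ) < D := by
    rcases lt_or_ge 0 (D : ℝ) with h | h
    · exact h
    · have : Real.log (D : ℝ) ≤ 0 := by
        have : (D : ℝ) = 0 := le_antisymm h (Nat.cast_nonneg D)
        rw [this, Real.log_zero]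
      linarith
  have hD3 : (3 : ℝ) ≤ D := by
    have hDexp : (D : ℝ) = Real.exp 𝓛 := by rw [h𝓛def, Real.exp_log hD0]
    have : Real.exp 3 ≤ Real.exp 𝓛 := Real.exp_le_exp.2 h𝓛3
    have h3 : (3 : ℝ) ≤ Real.exp 3 := by have := Real.add_one_le_exp (3 : ℝ); linarith
    linarith
  have hD2 : 2 ≤ D := by exact_mod_cast (show (2 : ℝ) ≤ D by linarith)
  have hχ1 : χ ≠ 1 := Lemma31.ne_one_of_isPrimitive χ hD2 hp
  have hA' : ‖χ.LFunction 1‖ ≤ 1 / Real.log D ^ 2022 := le_of_lt hA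
  -- `α < 1/30`
  have hαeq : alpha D = π / 𝓛 ^ 9 := alpha_eq D
  have hα30 : alpha D < 1 / 30 := by
    rw [hαeq, div_lt_div_iff₀ (by positivity) (by norm_num)]
    have h39 : (3 : ℝ) ^ 9 ≤ 𝓛 ^ 9 := pow_le_pow_left₀ (by norm_num) h𝓛3 9
    have hπ4 := Real.pi_lt_four
    nlinarith
  -- `|L′(1,χ)| ≥ ℓ₀`
  have hℓ : ℓ₀ ≤ ‖deriv χ.LFunction 1‖ := by
    have h := h57 D χ hp hq.sq_eq_one hL57 hA'
    have hφpos : (0 : ℝ) < Nat.totient D := by exact_mod_cast Nat.totient_pos.mpr (by omega)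
    have hφle : (Nat.totient D : ℝ) ≤ D := by exact_mod_cast Nat.totient_le D
    have hrat : (1 : ℝ) ≤ (D : ℝ) / Nat.totient D := by rw [le_div_iff₀ hφpos]; linarith
    calc ℓ₀ = Real.exp (-1) / 4 * 1 := (mul_one _).symm
      _ ≤ Real.exp (-1) / 4 * ((D : ℝ) / Nat.totient D) := by gcongr
      _ ≤ (deriv χ.LFunction 1).re := h
      _ ≤ ‖deriv χ.LFunction 1‖ := Complex.re_le_norm _
  -- `Kπ ≤ 𝓛⁸` and the `E ≤ ℓ₀α/4` condition
  have hKL : K * π ≤ Real.log D ^ 8 := hLKπ.trans (le_self_pow₀ h𝓛1 (by norm_num))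
  have hE : C₅ / Real.log D ^ 15 ≤ ℓ₀ * alpha D / 4 := by
    rw [hαeq, ← h𝓛def]
    rw [div_le_iff₀ (by positivity)]
    have h1 : 4 * C₅ ≤ ℓ₀ * π * 𝓛 := by rw [div_le_iff₀ (by positivity)] at hLC₅; linarith
    have h2 : 𝓛 ^ 15 = 𝓛 ^ 9 * 𝓛 ^ 6 := by ring
    have h3 : 𝓛 ≤ 𝓛 ^ 6 := le_self_pow₀ h𝓛1 (by norm_num)
    have h4 : ℓ₀ * π * 𝓛 ≤ ℓ₀ * π * 𝓛 ^ 6 := mul_le_mul_of_nonneg_left h3 (by positivity)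
    calc C₅ = 4 * C₅ / 4 := by ring
      _ ≤ ℓ₀ * π * 𝓛 ^ 6 / 4 := by linarith
      _ = ℓ₀ * (π / 𝓛 ^ 9) / 4 * 𝓛 ^ 15 := by rw [h2]; field_simp
  -- Lemma 8.3 (iii′) with `|C₈₃|`
  have hU3' : ∀ s : ℂ, ‖s - 1‖ ≤ 5 * alpha D → ‖U s - PiW χ d r‖ ≤
      Cabs * (ell D ^ 8)⁻¹ * ∏ q ∈ (d * r).primeFactors, (1 - (q : ℝ)⁻¹)⁻¹ := by
    intro s hs
    refine (hU3 s hs).trans ?_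
    have h1 := one_le_hatPi' (d * r)
    gcongr
    exact le_abs_self _
  have h := norm_circ_omega1_true_sub_main_kernel1 χ c' hp hχ1 h𝓛3 hA' hα30 j hd hr U hUd hCabs0
    (le_refl K) hKL hℓ₀0 hℓ hE hU3' hw hY hYP hΛ
  refine h.trans (le_of_eq ?_)
  rw [hCfin, hC₅, ell, ← h𝓛def]
  field_simp

/-- **The `ω₁`-circle evaluation, packaged, u025 form** (the difference of the circle integrals at two lengths
`Y₂`, `Y₁ ∈ [1, P]` against `Π(d,r)L′(1,χ)·β_{j+1}β_{j+2}(Y₂^{β₆−w} − Y₁^{β₆−w})/(β₆−w) = Π L′·circ025`,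
`Typed.Sec12B.circ025_eq`): same quantifiers, error `C·𝓛⁻¹⁵·Π̂²`.
[cite: Zhang2022LandauSiegel, §12 proof of Lemma 12.2, p. 69, tex L3534] [cite: Zhang2022LandauSiegel, §5 Lemma 5.7] -/
theorem circ_omega1_pair_eval_forAllLarge (c' C₈₃ : ℝ) :
    ∃ C : ℝ, 0 ≤ C ∧ ForAllLarge fun D _ χ => AssumptionA D χ →
      ∀ j : ℕ, ∀ d r : ℕ, d ≠ 0 → r ≠ 0 → ∀ U : ℂ → ℂ,
        DifferentiableOn ℂ U {s : ℂ | 9 / 10 < s.re} →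
        (∀ s : ℂ, ‖s - 1‖ ≤ 5 * alpha D → ‖U s - PiW χ d r‖ ≤
            C₈₃ * (ell D ^ 8)⁻¹ * ∏ q ∈ (d * r).primeFactors, (1 - (q : ℝ)⁻¹)⁻¹) →
        ∀ w : ℂ, ‖w‖ = alpha D → ∀ Y₁ Y₂ : ℝ, 1 ≤ Y₁ → Y₁ ≤ bigP D → 1 ≤ Y₂ → Y₂ ≤ bigP D →
          ∀ Λ : ℝ, 1 ≤ Λ →
          ‖((2 * π * I)⁻¹ * (∮ z in C(beta6 D - w, 3 * alpha D),
                U (1 - beta6 D + w + z) * χ.LFunction (1 - beta6 D + w + z + betaJ c' D (j + 1)) *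
                    χ.LFunction (1 - beta6 D + w + z + betaJ c' D (j + 2)) /
                    χ.LFunction (1 - beta6 D + w + z) *
                  (((Y₂ : ℝ) : ℂ) ^ (z + 0) * omega1 Λ (z + 0) / (z + 0))) -
              (2 * π * I)⁻¹ * (∮ z in C(beta6 D - w, 3 * alpha D),
                U (1 - beta6 D + w + z) * χ.LFunction (1 - beta6 D + w + z + betaJ c' D (j + 1)) *
                    χ.LFunction (1 - beta6 D + w + z + betaJ c' D (j + 2)) /
                    χ.LFunction (1 - beta6 D + w + z) *
                  (((Y₁ : ℝ) : ℂ) ^ (z + 0) * omega1 Λ (z + 0) / (z + 0)))) -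
              PiW χ d r * deriv χ.LFunction 1 *
                (betaJ c' D (j + 1) * betaJ c' D (j + 2) *
                  ((((Y₂ : ℝ) : ℂ) ^ (beta6 D - w) - ((Y₁ : ℝ) : ℂ) ^ (beta6 D - w)) /
                    (beta6 D - w)))‖ ≤
            C * (ell D ^ 15)⁻¹ * (∏ q ∈ (d * r).primeFactors, (1 - (q : ℝ)⁻¹)⁻¹) ^ 2 := by
  obtain ⟨C, hC0, D₀, hC⟩ := circ_omega1_eval_forAllLarge c' C₈₃
  refine ⟨2 * C, by positivity, D₀, fun D _ χ hD hq hp hA j d r hd hr U hUd hU3 w hw Y₁ Y₂ hY₁ hY₁P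
    hY₂ hY₂P Λ hΛ => ?_⟩
  have h₂ := hC D χ hD hq hp hA j d r hd hr U hUd hU3 w hw Y₂ hY₂ hY₂P Λ hΛ
  have h₁ := hC D χ hD hq hp hA j d r hd hr U hUd hU3 w hw Y₁ hY₁ hY₁P Λ hΛ
  -- abbreviate the values
  set A₂ := (2 * π * I)⁻¹ * (∮ z in C(beta6 D - w, 3 * alpha D),
      U (1 - beta6 D + w + z) * χ.LFunction (1 - beta6 D + w + z + betaJ c' D (j + 1)) *
          χ.LFunction (1 - beta6 D + w + z + betaJ c' D (j + 2)) / χ.LFunction (1 - beta6 D + w + z) *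
        (((Y₂ : ℝ) : ℂ) ^ (z + 0) * omega1 Λ (z + 0) / (z + 0))) with hA₂
  set A₁ := (2 * π * I)⁻¹ * (∮ z in C(beta6 D - w, 3 * alpha D),
      U (1 - beta6 D + w + z) * χ.LFunction (1 - beta6 D + w + z + betaJ c' D (j + 1)) *
          χ.LFunction (1 - beta6 D + w + z + betaJ c' D (j + 2)) / χ.LFunction (1 - beta6 D + w + z) *
        (((Y₁ : ℝ) : ℂ) ^ (z + 0) * omega1 Λ (z + 0) / (z + 0))) with hA₁
  set ellPi : ℂ := PiW χ d r * deriv χ.LFunction 1 with hellPi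
  set βa : ℂ := betaJ c' D (j + 1) with hβa
  set βb : ℂ := betaJ c' D (j + 2) with hβb
  set M₂ : ℂ := ellPi * (w - beta6 D + βa + βb + βa * βb * ((((Y₂ : ℝ) : ℂ) ^ (beta6 D - w) - 1) /
      (beta6 D - w))) with hM₂
  set M₁ : ℂ := ellPi * (w - beta6 D + βa + βb + βa * βb * ((((Y₁ : ℝ) : ℂ) ^ (beta6 D - w) - 1) /
      (beta6 D - w))) with hM₁
  have e : A₂ - A₁ - ellPi * (βa * βb * ((((Y₂ : ℝ) : ℂ) ^ (beta6 D - w) -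
      ((Y₁ : ℝ) : ℂ) ^ (beta6 D - w)) / (beta6 D - w))) = (A₂ - M₂) - (A₁ - M₁) := by
    rw [hM₂, hM₁]
    ring
  rw [e]
  refine (norm_sub_le _ _).trans ?_
  have h2C : 2 * C * (ell D ^ 15)⁻¹ * (∏ q ∈ (d * r).primeFactors, (1 - (q : ℝ)⁻¹)⁻¹) ^ 2 =
      C * (ell D ^ 15)⁻¹ * (∏ q ∈ (d * r).primeFactors, (1 - (q : ℝ)⁻¹)⁻¹) ^ 2 +
        C * (ell D ^ 15)⁻¹ * (∏ q ∈ (d * r).primeFactors, (1 - (q : ℝ)⁻¹)⁻¹) ^ 2 := by ring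
  rw [h2C]
  exact add_le_add h₂ h₁

end ShiftedCircleOmega

end Literature.NumberTheory.LFunctions.Zhang2022.Lemma84
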